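import Literature.MathematicalPhysics.QuantumFieldTheory.Balaban1985CMP102.Setting

/-!
# Bałaban CMP 102 (1985) 255–275, AS-PRINTED SPINE — `SectB`: Sect. B «An Inductive Assumption on the Form of Approximate
# Effective Actions», pp. 265–267 = PDF 11–13: the objects of (38)–(43) as binders over the concrete d = 3 carriers of
# `…Balaban1985CMP102.Setting`, the bridge to the 4D cell's carrier `B10.TowerRun`, and (41)/(47) BY NAME on it

Source: T. Bałaban, *Ultraviolet stability of three-dimensional lattice pure gauge field theories*, Commun. Math. Phys.
**102** (1985) 255–275 [Balaban1985UV3] ([B10]; `paper:balaban1985-cmp102-uv-stability-3d`; PDF page = journal page −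
254).  Quotations READ AS IMAGES on the renders `run/shared/lean/pub/pub-balaban/b2b-balaban-ref1/pages/
1985-cmp102-uv-stability-3d/…-p012-x2.png` (p. 266), `…-p013-x2.png` (p. 267) (displays (41), (43)–(47) are garbled in the
text layer); seat transcription `HOME/drafts/typer-1/TRANSCRIPTION-pp258-267.md` (lane pub-balaban3d); locators `p. N =
PDF n Lnn` = text-layer file lines.  [5] = [Balaban1985BackgroundPropagators], [7] = [Balaban1985Variational].

HONEST FRAMING (lane PLAN.md §0).  The inductive hypothesis (41) (upper bound) / (47) (lower bound) and the assembly of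
Theorem 2 ⇒ Theorem 1 are the 4D cell's `…Balaban1983to89.B10.{TowerRun, Ineq41, Ineq47, SpecOK, Step0Printed,
FirstStep36_37Printed, SectCStepPrinted, thm2_of_sections, bounds5At_of_ineqs, thm1Compact_of_thm2}` and
`…B10Assembly.{LeafSystem, thm1Compact_and_thm2_of_leafSystem}`, RE-USED BY NAME; the geometry (38)–(40) is
`…B10LargeField.{DomainSeq, Nested38, Sep39, Rule268, Chi40}`, the per-term shape (43) is `…B10SectCExpansion.Shape43`,
the summed bounds (44)–(46) are `…B10SectCExpansion.Bound44/Bound45`, `B10.Bound46Printed`, `…B10Eq44Concrete`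
(none restated here).  THIS FILE supplies what those abstract carriers leave open for the CONCRETE lattice approximation
`S : Setting.Scales L` with run objects `R : Setting.RunObjects S G`: the structure `TowerObjects` of BINDERS for the
printed objects of (38)–(43) that live above the Introduction (the large-field histories `{Ω_j, Λ_j, Z_j, V_j}`, the
sum-of-restricted-integrals functional of (41), the history-dependent minimizer `U_k` of (42), the interaction sum of
(43), `|Λ_k|`, `|Z_j|`, the constants `E^{(j)}` of (36)/(62), the `O(·)` coefficients of (41)), each field's docstring
quoting the sentence of print that introduces it, with the printed FORMULAS as definitions where print gives them (`E_k =
Σ_{j=k}^{K−1} E^{(j)}` (64) = `B10.Ek`; the `Z`-sum and the remainder sum of (41) literally; the main term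
`(1/g_k²)A^η(U_k)`; the regularity region of (44) p. 267 L2–3 `Reg44AsPrinted` and the «where»-clause of (47)
`Chi47Restriction` as `Setup.PlaqSmallOn`/`PlaqSmall` statements about the minimizer), and the map `toTowerRun :
TowerObjects → B10.TowerRun` (its proof fields `mainT_triv`, `Zterm_triv`,
`Ecst_eq`, `χ_nonneg`, `sites_nonneg` are one-line unfoldings).  Then (41), (47) for the concrete objects ARE
`B10.Ineq41/Ineq47 W.toTowerRun k` (`Ineq41AsPrinted`, `Ineq47AsPrinted`; unfolding lemmas `ineq41AsPrinted_iff`,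
`ineq47AsPrinted_iff` over the concrete objects); the binding of the
abstract slot «ρ_k satisfies (41), (47)» (`Setting.RunObjects.ineq41_47`) is set by `TowerObjects.pin` (`specOK_pin :
B10.SpecOK W.pin.toTowerRun`, via `pin_rho` — `pin` leaves `ρ_k` unchanged).  Nothing of the paper is asserted.  The construction of these
objects (and the leaves `B10Assembly.LeafSystem` about them) is the lane's carrier/prover seats' (PLAN §3.1 p1–p6).
-/

namespace Literature.MathematicalPhysics.QuantumFieldTheory.Balaban1985CMP102.SectB

open Literature.MathematicalPhysics.QuantumFieldTheory.Balaban1983to89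
open Literature.MathematicalPhysics.QuantumFieldTheory.Balaban1985CMP102.Setting
open _root_.MeasureTheory

/-! ## §1 The objects of (38)–(43) as binders (p. 266 = PDF 12, p. 267 = PDF 13) -/

/-- THE TOWER OBJECTS of one lattice approximation `S` (gauge group `G`): the Introduction's run objects
(`Setting.RunObjects`: `E`, `ε₁`, `Ū`, `T`, `U_k`, …) EXTENDED by binders for the objects Sect. B introduces.  p. 265 =
PDF 11 L30–32: «B. An Inductive Assumption on the Form of Approximate Effective Actions.  In this section we formulate
inequalities satisfied by all the actions ρ_k, k = 1, 2, …, K. To write them we have to introduce some new definitions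
and notations.»  Fields (each docstring quotes its sentence): the constants `M₁`, `b₀`, `p₀` of (7) p. 257 and the
remainder exponent `κ₀` (p. 262 L1 «κ₀ > 0»); `Hist k` = the large-field histories `{Ω_j}` of (38)–(40) (geometry typed
in the 4D cell's `B10LargeField.DomainSeq`/`Nested38`/`Sep39`/`Chi40`; the concrete history type is the carrier seat's —
a FINITE type, the scale-tagged large-field plaquette sets, which determine the regions: lane ruling R-HIST′); `triv k` = the history without large fields (every `Ω_j = T_η`; the only term of (47); p. 272
= PDF 18 L32–33 «The lower bound is proved in the same way, with all simplifications coming from the fact that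
Ω_{k+1} = T_η»); `LF` = the sum over `{Ω_j}` of the restricted integrals with their characteristic functions in
(41), applied to `exp` of an exponent depending on the history — with the two structural facts (41)'s use requires
(monotone in the exponent; `LF(F + t) = e^t·LF(F)`) as obligations ⟦reading R-HIST′ / RECORDED DIVERGENCE D-41: the
past large-field FIELDS `V_j` on `Z_j` of (41) are integrated into the nonnegative mass of each discrete history, and
print's exponent — which depends on the `V_j` through `U_k(V, {V_j})` of (42) — is evaluated at one selected field
history per discrete history (fibre supremum); print-(41) ⇒ lane-(41) by monotonicity of `exp`; the 4D cell's docstring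
reading `Hist k = {Ω_j, Λ_j, Z_j, V_j}` cannot be instantiated under its own `lf_mono`⟧; `UkH` = the minimizer `U_k`
of (42) for a history (at the selected field history);
`Pint` = the interaction sum `Σ_{j=1}^k Σ_{Y_j} 𝒫_j(Y_j, U_k)` of (41)/(43) (per-term shape = `B10SectCExpansion.Shape43`);
`Λvol` = `|Λ_k|`, `Zvol` = `|Z_j|`; `zcoef j` = the constant in «O(log g_j^{−1})|Z_j|» and `rcoef j` = the constant in
«O((L^jε)^{3+κ₀})|T₁^{(j)}|» of (41); `Estep j = E^{(j)}` of (36) p. 265 / (62) p. 271 with the identification `E = E₀ =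
Σ_{j<K} E^{(j)}` of the Introduction's `E` ((1); p. 265 L20 «E₁ = E − E^{(0)}», (64) p. 273 = PDF 19 L3 «E_k = Σ_{j=k}^{K−1}
E^{(j)}»). [cite: Balaban1985UV3, (38)–(43) p.266] -/
structure TowerObjects {L : ℕ} (S : Scales L) (G : Type) [Balaban1983to89.GaugeGroup G] [MeasurableSpace G]
    [Balaban1983to89.HaarData G] extends RunObjects S G where
  /-- «blocks of the size M₁, of the unit lattice T₁» (p. 257 L36–37); (39) «Ω_j is a union of big blocks of the size
  M₁L^jη» -/
  M₁ : ℝ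
  /-- (7) p. 257 L33–35 «p(g) = b₀(1 + log g^{−1})^{p₀}, p₀ > 2 and b₀ is a sufficiently large absolute constant» -/
  b₀ : ℝ
  /-- the exponent `p₀` of (7) -/
  p₀ : ℝ
  /-- p. 262 = PDF 8 L1 «the remainder by O(g₀⁷p¹⁸(g₀))|Ω₁| ≤ O(ε^{3+κ₀})|T₁|, κ₀ > 0»; (41) «O((L^jε)^{3+κ₀})|T₁^{(j)}|» -/
  κ₀ : ℝ
  /-- the admissible large-field histories at step `k`: (38) p. 266 = PDF 12 L7–9 «Thus we obtain a sequence of domains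
  Ω₁ ⊃ Ω₂ ⊃ ⋯ ⊃ Ω_k, Ω_j ⊂ T_η, (38) satisfying the conditions», (39) L10–11 «(L^jη)^{−1} dist(Ω_jᶜ, Ω_{j+1}) > R(g_j)M₁,
  R(g_j) = R₁r(g_j), (39)  Ω_j is a union of big blocks of the size M₁L^jη.», L12–13 «We define the sets Λ_j, 𝔅 as in [5],
  i.e. Λ_j = Ω_j^{(j)} \ Ω_{j+1}^{(j)}, and we denote Z_j = Ω_{j+1}^{(j)c} ⊂ T_{L^jη}^{(j)}. Gauge field configurations V_j are
  defined on Z_j, j = 0, 1, …, k − 1» and the characteristic functions (40) L15–18 «χ_j = Π_{p∈Λ_j} χ({|V_j(∂p) − 1| <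
  2L²g_{j−1}p(g_{j−1})}), j = 1, …, k, (40) where we have denoted V_k = V.» -/
  Hist : ℕ → Type
  /-- the history with no large fields (all `Ω_j = T_η`, all `Z_j = ∅`): the term of (47) (p. 272 = PDF 18 L32–33 «The
  lower bound is proved in the same way, with all simplifications coming from the fact that Ω_{k+1} = T_η.») -/
  triv : (k : ℕ) → Hist k
  /-- the functional of (41) p. 266 = PDF 12 L19–22: `LF k V F` = «Σ_{{Ω_j}} ∫dV_{k−1}↾_{Z_{k−1}} δ(V̄_{k−1}V^{−1})·⋯ ×
  ∫dV₀↾_{Z₀} δ(V̄₀V₁^{−1}) χ_kζ_{Λ_{k−1}}χ_{k−1}·⋯·ζ_{Λ₁}χ₁ζ_{Ω₁ᶜ} × exp[F]» as a function of the exponent `F` on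
  histories, at the configuration `V` on `T₁^{(k)}` -/
  LF : (k : ℕ) → Balaban1983to89.GaugeField S.P k G → (Hist k → ℝ) → ℝ
  /-- `LF` is monotone in the exponent (a sum of integrals of nonnegative functions against `exp F`) -/
  lf_mono : ∀ (k : ℕ) (V : Balaban1983to89.GaugeField S.P k G) (F F' : Hist k → ℝ),
    (∀ h, F h ≤ F' h) → LF k V F ≤ LF k V F'
  /-- `LF(F + t) = e^t·LF(F)` for a history-independent constant `t` -/
  lf_shift : ∀ (k : ℕ) (V : Balaban1983to89.GaugeField S.P k G) (F : Hist k → ℝ) (t : ℝ),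
    LF k V (fun h => F h + t) = Real.exp t * LF k V F
  /-- **(42)** p. 266 = PDF 12 L23–26: «The configuration U_k is determined by the variational problem considered in [7],
  i.e. it is a minimum of the functional  U → A^η(U), U: Ū^j = V_j on Λ_j, j = 0, 1, …, k, where we have put Λ₀ = Ω₁ᶜ and
  V_k = V. (42)» — `U_k(V, {V_j})` on `T_η` as a function of the history and of `V` (binder; [7] Thm 1 p. 279) -/
  UkH : (k : ℕ) → Hist k → Balaban1983to89.GaugeField S.P k G → Balaban1983to89.GaugeField S.P 0 G
  /-- at the history without large fields (42) is the Introduction's «minimal configuration … determined by the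
  configuration U on T₁^{(k)}» of (5): `U_k(V, ∅) = U_k(V)` -/
  UkH_triv : ∀ (k : ℕ) (V : Balaban1983to89.GaugeField S.P k G), UkH k (triv k) V = toRunObjects.Uk k V
  /-- the interaction sum «Σ_{j=1}^{k} Σ_{Y_j} 𝒫_j(Y_j, U_k)» of (41), with the terms of **(43)** p. 266 = PDF 12 L27–33:
  «The expressions 𝒫_j(Y_j,U_k) are defined similarly to (35) ⟦sic; (33)–(34)⟧: Y_j = (y, c₁, …, c_n), where y represents big blocks
  of L^jη-lattice, contained in Ω_k, i.e. y∈Ω_k^{(j)} ∩ M₁L^jηZ³, and c_i are bonds in Ω_k^{(j)}, |c_{i,−} − y| < R(g_j)M₁L^jη,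
  𝒫_j(Y_j,U_k) = ⟨𝒫_j(Y_j), B_k(c₁), …, B_k(c_n)⟩, n ≥ 2, B_k(c) = (1/i) log Ū_k^j(Γ_{y,c₋} ∪ c ∪ Γ_{c₊,y}), c∈Ω_k^{(j)},
  |𝒫_j(Y_j)| ≤ O(1) Π_{i=1}^{n} exp(−κ₁(M₁L^jη)^{−1}|c_{i,−} − y|). (43)» (per-term shape `B10SectCExpansion.Shape43`) -/
  Pint : (k : ℕ) → Hist k → Balaban1983to89.GaugeField S.P k G → ℝ
  /-- `|Λ_k|`, the number of sites of the last small-field region (p. 267 L10 «Summation over y gives the factor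
  (M₁L^jη)^{−3}|Λ_k|»), per history -/
  Λvol : (k : ℕ) → Hist k → ℝ
  /-- `Λ_k ⊂ T₁^{(k)}`: `|Λ_k| ≤ |T₁^{(k)}|` -/
  Λvol_le : ∀ (k : ℕ) (h : Hist k), Λvol k h ≤ S.sites k
  /-- «p ⊂ Ω_k» (p. 267 = PDF 13 L2 «regularity condition on Ω_k»; (42) «Λ₀ = Ω₁ᶜ»): the plaquettes of `T_η` lying in
  the last region `Ω_k` of the history -/
  plaqsIn : (k : ℕ) → Hist k → Set (Balaban1983to89.Plaq S.P 0)
  /-- no large fields ⇒ `Ω_k = T_η`: every plaquette ((47) «p ⊂ T_η») -/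
  plaqsIn_triv : ∀ k : ℕ, plaqsIn k (triv k) = Set.univ
  /-- `|Z_j|`, `j < k`, of (41) (p. 266 L23 «Here the sets Z_j are rescaled to the unit scale»), per history -/
  Zvol : (k : ℕ) → Hist k → ℕ → ℝ
  /-- no large fields ⇒ every `Z_j = ∅` -/
  Zvol_triv : ∀ (k j : ℕ), Zvol k (triv k) j = 0
  /-- the coefficient «O(log g_j^{−1})» of `|Z_j|` in (41), per `j` (the real number print names by its size; that size —
  `≤ C·(1 + log g_j^{−1})`, cf. the 4D cell's booked `B10SectAGathering.StepLeaves.ztermSucc` constant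
  `(C_z+C_v)g_j + C₅ + C₆ + (|log σ₀| + d(𝔤) log g_j^{−1})c₁` — is the content of the step leaves, not typed here) -/
  zcoef : ℕ → ℝ
  /-- the constant of the term «O((L^jε)^{3+κ₀})|T₁^{(j)}|» of (41)/(47), per `j` -/
  rcoef : ℕ → ℝ
  /-- `E^{(j)}`: (36) p. 265 = PDF 11 L18–20 «E^{(0)} = log σ₀|T₁*| + d(𝔤) log g₀|T₁*| + log Z^{(0)}(T₁, 1) + Σ_X 𝒫′₁(g₀,X,1)»,
  (62) p. 271 = PDF 17 L18–19 «The constant E_{k+1} is defined as E_{k+1} = E_k − E^{(k)}, where E^{(k)} = log σ₀|T₁^{(k)*}| +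
  d(𝔤) log g_k|T₁^{(k)*}| + log Z^{(k)}(T₁^{(k)}, 1) + Σ_X 𝒫′_{k+1}(g_k, X, 1). (62)» -/
  Estep : ℕ → ℝ
  /-- the Introduction's `E` of (1) IS `E₀ = Σ_{j<K} E^{(j)}`: p. 265 L20 «E₁ = E − E^{(0)}», p. 271 L18 «E_{k+1} = E_k −
  E^{(k)}», (64) p. 273 = PDF 19 L3 «E_k = Σ_{j=k}^{K−1} E^{(j)}» (`B10.Ek`) -/
  E_eq : toRunObjects.E = Balaban1983to89.B10.Ek Estep S.K 0

namespace TowerObjects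

/-- `|T₁^{(k)}| = (L^kε)^{−3}|T_ε| ≥ 0` (cf. the 4D cell's `B10Assembly.sitesRun_nonneg`, not imported here; private
plumbing for `toTowerRun`). [folklore] -/
private theorem scales_sites_nonneg {L : ℕ} (S : Scales L) (k : ℕ) : 0 ≤ S.sites k := by
  unfold Scales.sites Balaban1983to89.B10.sitesRun Scales.volT
  have hε := S.ε_pos
  have hL : (0 : ℝ) < (L : ℝ) := by have := S.hL.2; exact_mod_cast (by omega : 0 < L)
  positivity

variable {L : ℕ} {S : Scales L} {G : Type} [Balaban1983to89.GaugeGroup G] [MeasurableSpace G]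
  [Balaban1983to89.HaarData G] (W : TowerObjects S G)

/-- The main term of (41)/(47): `(1/g_k²)A^η(U_k)` with `U_k = U_k(V, {V_j})` of (42) (p. 266 = PDF 12 L20:
display (41) «exp[−(1/g_k²)A^η(U_k) + …]»), `g_k` = `Scales.gk` (= `B10.gRun`), `A^η` = `Scales.actionEta`. [cite: Balaban1985UV3, (41) p.266] -/
noncomputable def mainT (k : ℕ) (h : W.Hist k) (V : Balaban1983to89.GaugeField S.P k G) : ℝ :=
  (S.gk k)⁻¹ ^ 2 * S.actionEta k (W.UkH k h V)

/-- The `Z`-terms of (41) p. 266 = PDF 12 L19–22, literally: «+ Σ_{j=0}^{k−1} O(log g_j^{−1})|Z_j|» — the sum over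
`j < k` of the coefficient `zcoef j` (print's «O(log g_j^{−1})») times `|Z_j|` of the history. [cite: Balaban1985UV3, (41) p.266] -/
def Zterm (k : ℕ) (h : W.Hist k) : ℝ :=
  ∑ j ∈ Finset.range k, W.zcoef j * W.Zvol k h j

/-- `E_k` of (41)/(47): **(64)** p. 273 «E_k = Σ_{j=k}^{K−1} E^{(j)}» — the 4D cell's `B10.Ek` BY NAME on the profile
`E^{(j)} = Estep j`. [cite: Balaban1985UV3, (64) p.273] -/
def Ecst (k : ℕ) : ℝ :=
  Balaban1983to89.B10.Ek W.Estep S.K k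

/-- The remainder terms of (41)/(47) p. 266 = PDF 12 L19–22 / p. 267 = PDF 13 L17–18, literally: «Σ_{j=0}^{k−1}
O((L^jε)^{3+κ₀})|T₁^{(j)}|» with the `O(·)` constants `rcoef j` explicit, `|T₁^{(j)}|` = `Scales.sites`. [cite: Balaban1985UV3, (41) p.266] -/
noncomputable def Rm (k : ℕ) : ℝ :=
  ∑ j ∈ Finset.range k, W.rcoef j * ((L : ℝ) ^ j * S.ε) ^ (3 + W.κ₀) * S.sites j

/-- **p. 267 = PDF 13 L2–3, the sentence before (44)**, verbatim (render p013): «The configuration U_k satisfies the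
following regularity condition on Ω_k: |U_k(∂p) − 1| < 2L²B₃g_{k−1}p(g_{k−1})η².» — for the minimizer `U_k(V, {V_j})` of
(42) of the history `h`, on the plaquettes `p ⊂ Ω_k` (`plaqsIn`), with `|U(∂p) − 1|` = `Setup.dist1 ∘ plaqHol`
(`Setup.PlaqSmallOn`), `p(·)` = `B10.pFun b₀ p₀` of (7), `g_{k−1}` = `Scales.gk (k − 1)` (print has `k ≥ 1`; at `k = 0`
the truncated subtraction reads `g₀`), `η = L^{−k}`; `B₃` = the constant of [7] Thm 1 (9) p. 279 (binder).  The region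
form of display (44); it is the hypothesis `hreg` of the 4D cell's `B10Eq44Concrete.bound44_concrete` /
`B10Eq44AvgRegularity.reg44_avg_at` (there over the `ℤ³` lift).  Hypothesis-shaped; [7] Thm 1 is not asserted. [cite: Balaban1985UV3, p.267 (sentence before (44))] -/
def Reg44AsPrinted (B₃ : ℝ) (k : ℕ) (h : W.Hist k) (V : Balaban1983to89.GaugeField S.P k G) : Prop :=
  Balaban1983to89.PlaqSmallOn (W.plaqsIn k h)
    (2 * (L : ℝ) ^ 2 * B₃ * (S.gk (k - 1) * Balaban1983to89.B10.pFun W.b₀ W.p₀ (S.gk (k - 1))) * S.eta k ^ 2)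
    (W.UkH k h V)

/-- **(47), its «where»-clause** p. 267 = PDF 13 L19–20, verbatim: «where the characteristic function χ_k corresponds to
the restrictions on V given by the conditions |U_k(∂p) − 1| < g_kp(g_k)η², p ⊂ T_η.» — the restriction print attaches
to `χ_k` in (47): ALL plaquettes of `T_η`, minimizer `U_k(V)` of the history without large fields, threshold
`g_kp(g_k)η²`.  RECORDED IDENTIFICATION (cell pub-balaban GAPS G-pv15-1, not adjudicated here): the 4D cell's
`B10.Ineq47` — hence `Ineq47AsPrinted` — carries the Introduction's `χ` of (4) (`RunObjects.chi k`, threshold `ε₁`);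
print does not relate the two functions (deriving (5) from (47) uses `χ_(4) ≤ χ_k`, the regularity of [7] Thm 1). [cite: Balaban1985UV3, (47) p.267] -/
def Chi47Restriction (k : ℕ) (V : Balaban1983to89.GaugeField S.P k G) : Prop :=
  Balaban1983to89.PlaqSmall (S.gk k * Balaban1983to89.B10.pFun W.b₀ W.p₀ (S.gk k) * S.eta k ^ 2)
    (W.UkH k (W.triv k) V)

/-- The characteristic function (4) is nonnegative (it takes the values 0 and 1); private plumbing for `toTowerRun`. [folklore] -/
private theorem chi_nonneg (k : ℕ) (V : Balaban1983to89.GaugeField S.P k G) : 0 ≤ W.chi k V := by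
  unfold RunObjects.chi Balaban1983to89.chiSmall
  split_ifs <;> norm_num

/-- THE BRIDGE to the 4D cell's carrier of the inductive hypothesis: this lattice approximation with its tower objects as
a `B10.TowerRun` (extending `RunObjects.toRunData`): histories, the functional of (41), the main term, the interaction
sum, `|Λ_k|`, the `Z`-terms, `E_k`/`E^{(j)}` ((64) holds by `rfl`), the remainder sum, and the constants `M₁, b₀, p₀`.
Through it `B10.Ineq41`, `B10.Ineq47`, `B10.SpecOK`, `B10Assembly.LeafSystem`, … speak about the concrete objects. [cite: Balaban1985UV3, (41) p.266] -/
noncomputable def toTowerRun : Balaban1983to89.B10.TowerRun where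
  toRunData := W.toRunData
  Hist := W.Hist
  triv := W.triv
  LF := W.LF
  lf_mono := W.lf_mono
  lf_shift := W.lf_shift
  mainT := W.mainT
  mainT_triv := fun k V => by
    show (S.gk k)⁻¹ ^ 2 * S.actionEta k (W.UkH k (W.triv k) V) = (S.gk k)⁻¹ ^ 2 * S.actionEta k (W.Uk k V)
    rw [W.UkH_triv]
  Pint := W.Pint
  Λvol := W.Λvol
  Λvol_le := W.Λvol_le
  Zterm := W.Zterm
  Zterm_triv := fun k => by simp [Zterm, W.Zvol_triv]
  Ecst := W.Ecst
  Estep := W.Estep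
  Ecst_eq := fun _ => rfl
  Rm := W.Rm
  χ_nonneg := W.chi_nonneg
  sites_nonneg := scales_sites_nonneg S
  M₁ := W.M₁
  b₀ := W.b₀
  p₀ := W.p₀

/-! ## §2 (41) and (47) for the concrete objects, BY NAME -/

/-- **(41)** p. 266 = PDF 12 L19–23, verbatim (render p012): «Our inductive assumption has the following form  ρ_k(V) ≤
Σ_{{Ω_j}} ∫dV_{k−1}↾_{Z_{k−1}} δ(V̄_{k−1}V^{−1})·⋯ × ∫dV₀↾_{Z₀} δ(V̄₀V₁^{−1}) χ_kζ_{Λ_{k−1}}χ_{k−1}·⋯·ζ_{Λ₁}χ₁ζ_{Ω₁ᶜ} ×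
exp[−(1/g_k²)A^η(U_k) + Σ_{j=1}^{k} Σ_{Y_j} 𝒫_j(Y_j, U_k) − E_k + Σ_{j=0}^{k−1} O(log g_j^{−1})|Z_j| + Σ_{j=0}^{k−1}
O((L^jε)^{3+κ₀})|T₁^{(j)}|].  (41)  Here the sets Z_j are rescaled to the unit scale.» — the 4D cell's `B10.Ineq41` BY NAME
on `toTowerRun` ⟦reading D-41 (lane ruling R-HIST′): `Σ_{{Ω_j}} ∫dV ⋯` = the functional `LF` over the finite discrete
histories with the fields integrated into its mass, the exponent evaluated per discrete history; print-(41) ⇒ this⟧. [cite: Balaban1985UV3, (41) p.266] -/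
def Ineq41AsPrinted (k : ℕ) : Prop :=
  Balaban1983to89.B10.Ineq41 W.toTowerRun k

/-- (41) UNFOLDED over the concrete objects (definitional, `Iff.rfl`): for every `V` on `T₁^{(k)}`, `ρ_k(V) ≤ LF_k(V)[h ↦
−(1/g_k²)A^η(U_k(V,h)) + Σ_jΣ_{Y_j}𝒫_j(Y_j,U_k) − E_k + Σ_{j<k} zcoef_j |Z_j|(h) + Σ_{j<k} rcoef_j (L^jε)^{3+κ₀}|T₁^{(j)}|]` — the
five summands of the printed exponent in the printed order.  Recorded so the referee can countersign (41) token by token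
on THIS file. [cite: Balaban1985UV3, (41) p.266] -/
theorem ineq41AsPrinted_iff (k : ℕ) :
    W.Ineq41AsPrinted k ↔
      ∀ V : Balaban1983to89.GaugeField S.P k G,
        W.rho k V ≤ W.LF k V (fun h => -((S.gk k)⁻¹ ^ 2 * S.actionEta k (W.UkH k h V)) +
            W.Pint k h V - W.Ecst k + W.Zterm k h + W.Rm k) :=
  Iff.rfl

/-- **(47)** p. 267 = PDF 13 L17–20, verbatim (render p013): «Analogously to (37) we assume the lower bound  ρ_k(V) ≥ χ_k
exp[−(1/g_k²)A^η(U_k) + Σ_{j=1}^{k} Σ_{Y_j} 𝒫_j(Y_j,U_k) − E_k − Σ_{j=0}^{k−1} O((L^jε)^{3+κ₀})|T₁^{(j)}|],  (47)  where the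
characteristic function χ_k corresponds to the restrictions on V given by the conditions |U_k(∂p) − 1| < g_kp(g_k)η²,
p ⊂ T_η.» — the 4D cell's `B10.Ineq47` BY NAME on `toTowerRun` (whose `χ` is the Introduction's (4) with threshold
`RunObjects.ε₁ k`; print's χ_k here restricts `V` through `U_k(V)` — the identification is recorded, cell pub-balaban GAPS G-pv15-1). [cite: Balaban1985UV3, (47) p.267] -/
def Ineq47AsPrinted (k : ℕ) : Prop :=
  Balaban1983to89.B10.Ineq47 W.toTowerRun k

/-- (47) UNFOLDED over the concrete objects (definitional up to the rewrite `U_k(V, ∅) = U_k(V)`): for every `V` on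
`T₁^{(k)}`, `χ(V)·exp[−(1/g_k²)A^η(U_k(V)) + Σ_jΣ_{Y_j}𝒫_j(Y_j,U_k) − E_k − Σ_{j<k} rcoef_j (L^jε)^{3+κ₀}|T₁^{(j)}|] ≤ ρ_k(V)`.
Recorded so the referee can countersign (47) token by token on THIS file. [cite: Balaban1985UV3, (47) p.267] -/
theorem ineq47AsPrinted_iff (k : ℕ) :
    W.Ineq47AsPrinted k ↔
      ∀ V : Balaban1983to89.GaugeField S.P k G,
        W.chi k V * Real.exp (-((S.gk k)⁻¹ ^ 2 * S.actionEta k (W.UkH k (W.triv k) V)) +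
            W.Pint k (W.triv k) V - W.Ecst k - W.Rm k) ≤ W.rho k V :=
  Iff.rfl

/-! ## §3 Pinning the abstract slot «ρ_k satisfies (41), (47)» -/

/-- The same tower objects with the Introduction's abstract slot `RunObjects.ineq41_47` («ρ_k satisfies the inequalities
(41), (47)», `B10.RunData.Ineq41_47`) SET TO the typed displays `(41)_k ∧ (47)_k` of `toTowerRun` (which do not read that
slot).  This is how a construction makes `B10.SpecOK` — the hypothesis `B10Assembly.LeafSystem.spec` — hold
(`specOK_pin`). [cite: Balaban1985UV3, Thm 2 p.272] -/
noncomputable def pin : TowerObjects S G :=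
  { W with ineq41_47 := fun k =>
      Balaban1983to89.B10.Ineq41 W.toTowerRun k ∧ Balaban1983to89.B10.Ineq47 W.toTowerRun k }

/-- `pin` does not change the densities **(2)** p. 256 («ρ_{k+1} = Tρ_k», `ρ₀` by (1)): `ρ_k` reads only `E` and `T`
(propositional — `RunObjects.rho` is recursive in `k`; every other object of `pin W` is definitionally that of `W`).
Re-derived bookkeeping, no content of the paper. [cite: Balaban1985UV3, (2) p.256] -/
theorem pin_rho : ∀ k : ℕ, W.pin.rho k = W.rho k
  | 0 => rfl
  | k + 1 => by
    show (W.T k).T (W.pin.rho k) = (W.T k).T (W.rho k)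
    rw [pin_rho k]

/-- (41) p. 266 for the pinned objects is (41) for the original ones.  Re-derived bookkeeping, no content of the
paper. [cite: Balaban1985UV3, (41) p.266] -/
theorem ineq41_pin_iff (k : ℕ) :
    Balaban1983to89.B10.Ineq41 W.pin.toTowerRun k ↔ Balaban1983to89.B10.Ineq41 W.toTowerRun k :=
  forall_congr' fun U => by
    have h : W.pin.toTowerRun.ρ k U = W.toTowerRun.ρ k U := congrFun (W.pin_rho k) U
    rw [h]
    exact Iff.rfl

/-- (47) p. 267 for the pinned objects is (47) for the original ones.  Re-derived bookkeeping, no content of the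
paper. [cite: Balaban1985UV3, (47) p.267] -/
theorem ineq47_pin_iff (k : ℕ) :
    Balaban1983to89.B10.Ineq47 W.pin.toTowerRun k ↔ Balaban1983to89.B10.Ineq47 W.toTowerRun k :=
  forall_congr' fun U => by
    have h : W.pin.toTowerRun.ρ k U = W.toTowerRun.ρ k U := congrFun (W.pin_rho k) U
    rw [h]
    exact Iff.rfl

/-- For the pinned objects the 4D cell's binding `B10.SpecOK` — the hypothesis `B10Assembly.LeafSystem.spec` — HOLDS:
the slot of `pin W` is `(41)_k ∧ (47)_k` of `W`, which are `(41)_k ∧ (47)_k` of `pin W` (`ineq41_pin_iff`,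
`ineq47_pin_iff`) — Theorem 2 p. 272 «satisfies the inequalities (41), (47)» as the CONTENT of the slot.  Re-derived
bookkeeping, no content of the paper. [cite: Balaban1985UV3, Thm 2 p.272] -/
theorem specOK_pin : Balaban1983to89.B10.SpecOK W.pin.toTowerRun :=
  fun k => (and_congr (W.ineq41_pin_iff k) (W.ineq47_pin_iff k)).symm

/-- `pin` changes nothing the Introduction's statements read: the bounds **(5)** p. 256 on `pin W` are the bounds (5) on
`W`.  Re-derived bookkeeping, no content of the paper. [cite: Balaban1985UV3, (5) p.256] -/
theorem bounds5_pin_iff (O1 : ℝ) :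
    Balaban1983to89.B10.Bounds5 W.pin.toRunData O1 ↔ Balaban1983to89.B10.Bounds5 W.toRunData O1 :=
  forall_congr' fun k => forall_congr' fun _ => forall_congr' fun U => by
    have h : W.pin.toRunData.ρ k U = W.toRunData.ρ k U := congrFun (W.pin_rho k) U
    rw [h]
    exact Iff.rfl

end TowerObjects

end Literature.MathematicalPhysics.QuantumFieldTheory.Balaban1985CMP102.SectB
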